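import Literature.MathematicalPhysics.QuantumFieldTheory.Balaban1983to89.Node00.OpsYExpsOfRecordV2
import Literature.MathematicalPhysics.QuantumFieldTheory.Balaban1983to89.B9WalkLettersOpsO

/-!
# `Balaban1983to89.Node00.OpsYExpsOfRecordV3` — T. Bałaban, *Propagators for lattice gauge theories in a background field*, Commun. Math. Phys. **99**
# (1985) 389–434 [Balaban1985BackgroundPropagators], Thms 3.7–3.13 pp. 409–426, (3.87)–(3.90) p. 409 (the cube operators `G′_□(U)` of Theorem 3.7),
# p. 410 L14–15 (the reading domain): THE EXPANSION-LETTER RECORD `𝔈` OF STAGE 3′(Y) WITH THE CUBE-LETTER FAMILY `O` AND THE READING DOMAIN `near`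
# AS PARAMETERS — `expsYOfRecordV3`, its seven faces, `pins_of_eq`, and `expsYOfRecordV3 … (GsqY-letters) (nearDomY) = expsYOfRecordV2 …` (`rfl`)

statement-level skeleton of published theorems with citation tags; proofs where landed; nothing here is a claim about the Yang–Mills mass gap

THE PRINT.  p. 409, Theorem 3.7: the random-walk expansion (3.90) of `G′(U)` is generated by the operators `G′_□(U)` *«of the sequence {Ω_n(□)} of the
cube □»* through the identities (3.87)–(3.89); which local operator `G′_□(U)` is used (the cube's own local inverse `(Δ′_{U,□})⁻¹`, or — for the
bounds (3.42) of every member of the class — the restricted-configuration letter of p. 410 L14–15 *«U restricted to Ω₀(□)»*) is a CHOICE the expansion's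
algebra does not see: (3.87)–(3.89) need only the two local-inverse laws (3.88) of the chosen family and its locality.  V2 (`Node00.OpsYExpsOfRecordV2`)
fixed that choice to def-Y's `GsqY … (cubeDomY x □)` inside dag-n06-d's walk letters `opsWalkY` and the reading domain to `nearDomY x`; dag-n06-d's
`B9WalkLettersOpsO` (W-a FILE C-3) makes both GENERIC: `opsWalkYO … O` (slot `Gsq U □ := GcoS … (O □) U`, `O □ : SiteOpY` a cube LETTER),
`dirOpsWalkYO ∕ dirLettersWalkYO … O`, `rdWalkYO … near`, with `opsWalkYO … (fun □ => GsqY … (cubeDomY x □)) = opsWalkY` and `rdWalkYO … (nearDomY x)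
= rdWalkY` by `rfl`, and proves the walk laws (`staticOK_opsWalkYO`, `identities₂_opsWalkYO` from the two (3.88) laws AT `O`, `kopDir_opsWalkYO_eq`,
`localityDir_opsWalkYO` from the locality of `O` on `near ⊇ nearDomY`) for ANY such family.

WHY THIS FILE (pub-ymgap bus 2026-08-30: dag-n06-d g23 INTENT-5 ∕ FILED-6 p769851 «your exps V3 can take `opsWalkYO … (O x)` ∕ `dirOpsWalkYO` ∕
`dirLettersWalkYO` ∕ `rdWalkYO … (near x)` with `O near` as record PARAMETERS (road (A)) … V3 ⊇ V2 definitionally and the certificate re-pins in one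
edition»; node00-def-Y g31 WORD-100 «road (A), two new record parameters `(O, near)`, everything else byte-identical to V2»; director-ym R168 row (2):
def-Y owns the `OpsY` instance at the record and its residual parameter layer).  The N06 certificate of record binds `h𝔈 : 𝔈 = expsYOfRecordV2 …` and
recovers the seven pins by `OpsYExpsOfRecordV2.pins_of_eq h𝔈`; to re-pin rows 17–19 to the (R)-design cube letters (dag-n06-c's `locLetterY …`, the
all-members (3.42) supply `local342_of_blocks_pins`) it needs the SAME record with the cube-letter family and the reading domain FREE.  This file is that
record; the laws of `O` (the (3.88) local-inverse laws, the locality on `near`) are deliberately NOT fields or hypotheses here (road (A)): they stay the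
certificate's displayed ∕ discharged binders through dag-n06-d's `identities₂_opsWalkYO ∕ localityDir_opsWalkYO`.

WHAT THIS FILE DOES (definitions by field copy + `rfl` transport; record-level knit file importing V2 and `B9WalkLettersOpsO`; V1 ∕ V2 untouched):
* §1 ★★ `expsYOfRecordV3 N θ M⋆ 𝔯 𝔈₀ R₁ R₂ bI α′ r39 B39 p q p3 q3 pM qM H O near 𝔬A rdA 𝔬12 : ExpsY N θ M⋆` — V2's record with TWO NEW PARAMETERS placed
  after `H`: the cube-letter family `O : ∀ x, ↥(cubes x.toKIdx.D.toDomains) → SiteOpY (M_N ℂ) x.toKIdx` and the reading domain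
  `near : ∀ x, ↥(cubes x.toKIdx.D.toDomains) → Finset (SiteY x.toKIdx)`; the `E37` slot is the definite `PairM` E-letter over
  `opsWalkYO … (O x) ∕ dirOpsWalkYO … (O x) ∕ dirLettersWalkYO … (O x) ∕ rdWalkYO … (near x)`; the six other replaced fields (`EK39 ∕ PosDef ∕ E310 ∕ HasRWExp ∕
  HasRWExpH ∕ PosDefK`) and the three kept ones are V2's VERBATIM (`E310` stays over the abstract bond-sector readers `𝔬A rdA`; the transporter stays
  `parSymY`); field lemmas in both typings (`_kept ∕ _idem ∕ _sectD ∕ _posDef ∕ _EK39 ∕ _E37 ∕ _E310`).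
* §2 ★★★ `expsYOfRecordV3_GsqY_nearDomY`: AT `O := fun x □ => GsqY x.toKIdx (parSymY x.toKIdx) (cubeDomY x □)` AND `near := fun x => nearDomY x` THE RECORD
  IS `expsYOfRecordV2 …` (`rfl`, through `opsWalkYO_GsqY ∕ rdWalkYO_nearDomY`) — so V3 ⊇ V2 definitionally and every landed fact about V2's pins is a
  fact about V3 at that instance; `h𝔈`-converters both ways (`eq_V2_of_eq_V3_GsqY ∕ eq_V3_of_eq_V2`).
* §3 ★★ the SEVEN FACES at the star instance `opsYNuStOfRecordV4PE N θ M⋆ 𝔯 𝔢 𝔴 (expsYOfRecordV3 …)` in EXACTLY the certificate's binder shapes, all `rfl`,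
  and ★★★ `pins_of_eq : 𝔈 = expsYOfRecordV3 … → ⟨hEK39, hPD, hE37, hE310, hpinE, hpinH, hpinK⟩` (+ `pinsSt_of_eq ∕ pinsNu_of_eq ∕ pinsP_of_eq` at the plain
  star and the two source instances) — V2's §2 with `hE37` over the `O`-letters.
NAMES.  §3's face names coincide BY DESIGN with V1's ∕ V2's (namespace `…Node00.OpsYExpsOfRecordV3`; distinct fully-qualified names — pub-ymgap dag-lead
DEDUP WORDS 61); a consumer opening two of the namespaces qualifies, e.g. `OpsYExpsOfRecordV3.pins_of_eq h𝔈`.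

HONEST SCOPE.  Definitional packaging of def-Y's own residual parameter and `rfl` transport; no inequality, expansion or positivity statement of the
paper is proved or asserted (the fields are PREDICATES whose truth the certificate's rows display as hypotheses); the cube-letter family `O`, its laws,
the reading domain `near`, the regularity classes `R₁ R₂`, the readers `𝔬A rdA 𝔬12`, the block map `bI`, the local hypothesis `H` and the numerics stay the
certificate's binders.  Nothing landed is modified; N06 is NOT discharged; NOT continuum, NOT OS, NOT the mass gap.  Filed by the pub-ymgap def-Y owner
lineage (`pub-ymgap-node00-def-Y`, gen 31).  Net new unproved facts: 0.
-/

noncomputable section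

namespace Literature.MathematicalPhysics.QuantumFieldTheory.Balaban1983to89.Node00.OpsYExpsOfRecordV3


open Node00
open B9PinMembersKLevelV1 (MemberY geo9Y bg9Y)
open B9BackgroundsKLevelV1R (RegFamY bg9YR regY335 regY336 kernelFamilyR rwExpansionR rwKernelExpansionR)
open B9OpsRTransport (ops312RY)
open B7Prop2SpecialUnitary (specialUnitaryUnits)
open B6Cover236MultiLevelBlocks (cubes)
open B9Thm37Whole (Ops)
open B9Cor38Whole (WalkReading)
open B9Thm310Whole (Ops310 WalkReading310)
open B9Thm311Whole (PosDefOfOps)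
open B9Thm311ReadingAtLetters (ops311Y)
open B9Thm311PosAtRecordV4 (proofLettersGA)
open B9Thm39WholeBlkViaDatum (EK39OfOpsBlkVia)
open B9Thm39ReadingFaithful (repSite39F)
open B9Thm39OneCubeReadingAtLettersY (oneCubeReading39)
open B9Thm39PureGaugeClassAtLettersR (oneCubeOps39YFR)
open B9RowSum261DefiniteFaces (rowConst261)
open B9Thm312Whole (HasRWExpOfOps HasRWExpHOfOps PosDefKOfOps)
open B9RWSumsDefinitePins (PinPrims)
open B9RWSumsDefinitePinsPair (PairPrims)
open B9RWSumsDefinitePinsPairM (MixedPrims E310YPairM)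
open B9RWSumsDefinitePinsPairMDir (E37YPairMDir)
open B9CoReadingCoordsTranspose (TrIdx trBasis)
open B9CoReadingCoords (XBK)
open B9CoReadingCoordsS (XSK)
open B9CoReadingCoordsH (XHK)
open B9GeoNbrCountKLevelV1 (nbrCountY)
open scoped Matrix.Norms.L2Operator

open B9WalkLettersOps (nearDomY)
open B9WalkLettersOpsO (opsWalkYO dirOpsWalkYO dirLettersWalkYO rdWalkYO)
open B9WalkLettersCoordsS (cubeDomY)
open Node00.OpsYLocalInverse (GsqY)

/-! ## §1 ★★ The expansion-letter record of record, class-parametric typing, generic cube letter `O` and reading domain `near` -/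

section Defn

/-- ★★ **THE EXPANSION LETTERS OF RECORD, `R`-TYPING** `𝔈 := expsYOfRecordV3 N θ M⋆ 𝔯 𝔈₀ R₁ R₂ bI α′ r39 B39 p q p3 q3 pM qM H O near 𝔬A rdA 𝔬12`: the base
record `𝔈₀` with the seven fields the N06 certificate of record PINS replaced by its right-hand sides, read back to the member carrier `bg9Y x` by the
inverse re-typings of V2's §0 — Theorem 3.9's kernel expansion of `(Q′G′²Q′*)⁻¹` read blockwise off the one-cube letters over `bg9YR R₁ R₂ x` on the faithful
block map (`EK39`), Theorem 3.11's five positivity statements at the letters (`PosDef`), the definite `PairM` E-letter of Theorems 3.7 ∕ 3.8 over THE WALK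
LETTERS WITH A GENERIC CUBE LETTER `opsWalkYO … (O x) ∕ dirOpsWalkYO ∕ dirLettersWalkYO ∕ rdWalkYO … (near x)` (dag-n06-d's `B9WalkLettersOpsO`) at basis
`trBasis N`, transporter `parSymY`, block map `bI x`, CUBE-LETTER FAMILY `O x` and READING DOMAIN `near x` — the two new record parameters (`E37`), the definite
`PairM` E-letter of Theorem 3.10 over the bond-sector readers `𝔬A rdA` (`E310`) — both fed `kernelFamilyR R₁ R₂` of the record's own site ∕ bond kernel
families — and Theorems 3.12 ∕ 3.13's perturbation series ∕ positivity over the Sect.-D letters `ops312RY (𝔬12 x)` (`HasRWExp ∕ HasRWExpH ∕ PosDefK`);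
`IsAnalyticExt ∕ GivenBy3185 ∕ HasRWExpC` are `𝔈₀`'s.
[cite: Balaban1985BackgroundPropagators, Thm 3.7 (3.90) p.409 + Cor. 3.8 (3.93)–(3.94) p.410, Thm 3.9 (3.98)–(3.99) pp.412–413, Thm 3.10 (3.107)–(3.108) pp.415–416,
Thm 3.11 p.416, Thm 3.12 p.423 + (3.130) p.421 + (3.138) p.423, Thm 3.13 p.426 + (3.147)–(3.148) p.425, (3.35)–(3.36) p.396 (the class as a parameter)] -/
def expsYOfRecordV3 (N : ℕ) (θ : Stage3Params) (Mstar : ℕ) (𝔯 : ResY N θ Mstar) (𝔈₀ : ExpsY N θ Mstar)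
    [∀ x : MemberY θ.d₆ θ.ℓ₆ θ.hd' θ.hL' θ.b₀ θ.b₁ Mstar, Fintype (geo9Y x).Site]
    [∀ x : MemberY θ.d₆ θ.ℓ₆ θ.hd' θ.hL' θ.b₀ θ.b₁ Mstar, DecidableEq (geo9Y x).Site]
    (R₁ R₂ : RegFamY θ.d₆ θ.ℓ₆ θ.hd' θ.hL' θ.b₀ θ.b₁ Mstar (Matrix (Fin N) (Fin N) ℂ))
    (bI : ∀ x : MemberY θ.d₆ θ.ℓ₆ θ.hd' θ.hL' θ.b₀ θ.b₁ Mstar, FBondY x.toKIdx → IBondY x.toKIdx) (α' r39 B39 : ℝ) (p q : PinPrims)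
    (p3 q3 : PairPrims) (pM qM : MixedPrims) (H : MemberY θ.d₆ θ.ℓ₆ θ.hd' θ.hL' θ.b₀ θ.b₁ Mstar → Prop)
    (O : ∀ x : MemberY θ.d₆ θ.ℓ₆ θ.hd' θ.hL' θ.b₀ θ.b₁ Mstar, ↥(cubes x.toKIdx.D.toDomains) → SiteOpY (Matrix (Fin N) (Fin N) ℂ) x.toKIdx)
    (near : ∀ x : MemberY θ.d₆ θ.ℓ₆ θ.hd' θ.hL' θ.b₀ θ.b₁ Mstar, ↥(cubes x.toKIdx.D.toDomains) → Finset (SiteY x.toKIdx))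
    {ιA AA : MemberY θ.d₆ θ.ℓ₆ θ.hd' θ.hL' θ.b₀ θ.b₁ Mstar → Type} [∀ x, Fintype (ιA x)] [∀ x, Fintype (AA x)]
    (𝔬A : ∀ x : MemberY θ.d₆ θ.ℓ₆ θ.hd' θ.hL' θ.b₀ θ.b₁ Mstar, Ops310 (geo9Y x)
      (bg9YR (Matrix (Fin N) (Fin N) ℂ) (specialUnitaryUnits (Fin N)) R₁ R₂ x) (XBK (TrIdx N) x.toKIdx) (XBK (TrIdx N) x.toKIdx) (ιA x) (AA x))
    (rdA : ∀ x : MemberY θ.d₆ θ.ℓ₆ θ.hd' θ.hL' θ.b₀ θ.b₁ Mstar, WalkReading310 (geo9Y x)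
      (bg9YR (Matrix (Fin N) (Fin N) ℂ) (specialUnitaryUnits (Fin N)) R₁ R₂ x) (XBK (TrIdx N) x.toKIdx) (ιA x) (AA x))
    (𝔬12 : ∀ x : MemberY θ.d₆ θ.ℓ₆ θ.hd' θ.hL' θ.b₀ θ.b₁ Mstar, B9Thm312Whole.Ops (geo9Y x)
      (bg9YR (Matrix (Fin N) (Fin N) ℂ) (specialUnitaryUnits (Fin N)) R₁ R₂ x) (XBK (TrIdx N) x.toKIdx) (XBK (TrIdx N) x.toKIdx) (XHK (TrIdx N) x.toKIdx)
      (XSK (TrIdx N) x.toKIdx)) :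
    ExpsY N θ Mstar := fun x =>
  { 𝔈₀ x with
    EK39 := OpsYExpsOfRecordV2.rwKernelExpansionRY
      (EK39OfOpsBlkVia (oneCubeOps39YFR θ Mstar (lettersYOfRecordV4P N θ Mstar 𝔯) R₁ R₂ bI x) (oneCubeReading39 _) (θ.d₆ + 1)
        (2 * (1 * B39) * rowConst261 (geo9Y (d := θ.d₆) (ℓ := θ.ℓ₆) (hd := θ.hd') (hL := θ.hL') (b₀ := θ.b₀) (b₁ := θ.b₁) (Mstar := Mstar)) (α' * r39))
        ((1 - α') * r39) (repSite39F x.toKIdx (bI x)))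
    PosDef := PosDefOfOps (ops311Y x (lettersYOfRecordV4P N θ Mstar 𝔯 x) (proofLettersGA (lettersYOfRecordV4P N θ Mstar 𝔯 x)))
    E37 := OpsYExpsOfRecordV2.rwExpansionRY
      (E37YPairMDir (bg := (bg9YR (Matrix (Fin N) (Fin N) ℂ) (specialUnitaryUnits (Fin N)) R₁ R₂)) (2 * (θ.d₆ + 1))
        (nbrCountY θ.d₆ θ.ℓ₆ θ.hd' θ.hL' θ.b₀ θ.b₁ 2) (Real.sqrt ((θ.d₆ + 1) * Fintype.card (TrIdx N))) ((θ.d₆ + 1 : ℕ) : ℝ) p q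
        (⟨p3.N3, 2 * p3.B3, 0⟩ : PairPrims) (⟨q3.N3, 2 * q3.B3, 0⟩ : PairPrims) pM qM
        (opsWalkYO x (trBasis N) (bg9YR (Matrix (Fin N) (Fin N) ℂ) (specialUnitaryUnits (Fin N)) R₁ R₂ x) (fun U => U) (parSymY x.toKIdx) (bI x) (O x))
        (dirOpsWalkYO x (trBasis N) (bg9YR (Matrix (Fin N) (Fin N) ℂ) (specialUnitaryUnits (Fin N)) R₁ R₂ x) (fun U => U) (parSymY x.toKIdx) (bI x) (O x))
        (dirLettersWalkYO x (trBasis N) (bg9YR (Matrix (Fin N) (Fin N) ℂ) (specialUnitaryUnits (Fin N)) R₁ R₂ x) (fun U => U) (parSymY x.toKIdx) (bI x) (O x))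
        (rdWalkYO x (bg9YR (Matrix (Fin N) (Fin N) ℂ) (specialUnitaryUnits (Fin N)) R₁ R₂ x) (fun U => U) (parSymY x.toKIdx) (near x)) (H x)
        (kernelFamilyR R₁ R₂
          (kernelFamilyS x.toKIdx (bg9Y (Matrix (Fin N) (Fin N) ℂ) (specialUnitaryUnits (Fin N)) x) (fun U => U) (lettersYOfRecordV4P N θ Mstar 𝔯 x).Gp
            (lettersYOfRecordV4P N θ Mstar 𝔯 x).parS)))
    E310 := OpsYExpsOfRecordV2.rwExpansionRY
      (E310YPairM (bg := (bg9YR (Matrix (Fin N) (Fin N) ℂ) (specialUnitaryUnits (Fin N)) R₁ R₂)) (2 * (θ.d₆ + 1))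
        (nbrCountY θ.d₆ θ.ℓ₆ θ.hd' θ.hL' θ.b₀ θ.b₁ 2) (Real.sqrt ((θ.d₆ + 1) * Fintype.card (TrIdx N))) ((θ.d₆ + 1 : ℕ) : ℝ) p q
        (⟨p3.N3, 2 * p3.B3, 0⟩ : PairPrims) (⟨q3.N3, 2 * q3.B3, 0⟩ : PairPrims) pM qM (𝔬A x) (rdA x) (H x)
        (kernelFamilyR R₁ R₂
          (kernelFamilyB x.toKIdx (bg9Y (Matrix (Fin N) (Fin N) ℂ) (specialUnitaryUnits (Fin N)) x) (fun U => U) (lettersYOfRecordV4P N θ Mstar 𝔯 x).GA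
            (lettersYOfRecordV4P N θ Mstar 𝔯 x).parB)))
    HasRWExp := HasRWExpOfOps (ops312RY (𝔬12 x))
    HasRWExpH := HasRWExpHOfOps (ops312RY (𝔬12 x))
    PosDefK := PosDefKOfOps (ops312RY (𝔬12 x)) }

end Defn

section Faces

variable (N : ℕ) (θ : Stage3Params) (Mstar : ℕ) (𝔯 : ResY N θ Mstar) (𝔈₀ : ExpsY N θ Mstar)
  [∀ x : MemberY θ.d₆ θ.ℓ₆ θ.hd' θ.hL' θ.b₀ θ.b₁ Mstar, Fintype (geo9Y x).Site]
  [∀ x : MemberY θ.d₆ θ.ℓ₆ θ.hd' θ.hL' θ.b₀ θ.b₁ Mstar, DecidableEq (geo9Y x).Site]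
  (R₁ R₂ : RegFamY θ.d₆ θ.ℓ₆ θ.hd' θ.hL' θ.b₀ θ.b₁ Mstar (Matrix (Fin N) (Fin N) ℂ))
  (bI : ∀ x : MemberY θ.d₆ θ.ℓ₆ θ.hd' θ.hL' θ.b₀ θ.b₁ Mstar, FBondY x.toKIdx → IBondY x.toKIdx) (α' r39 B39 : ℝ) (p q : PinPrims)
  (p3 q3 : PairPrims) (pM qM : MixedPrims) (H : MemberY θ.d₆ θ.ℓ₆ θ.hd' θ.hL' θ.b₀ θ.b₁ Mstar → Prop)
    (O : ∀ x : MemberY θ.d₆ θ.ℓ₆ θ.hd' θ.hL' θ.b₀ θ.b₁ Mstar, ↥(cubes x.toKIdx.D.toDomains) → SiteOpY (Matrix (Fin N) (Fin N) ℂ) x.toKIdx)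
    (near : ∀ x : MemberY θ.d₆ θ.ℓ₆ θ.hd' θ.hL' θ.b₀ θ.b₁ Mstar, ↥(cubes x.toKIdx.D.toDomains) → Finset (SiteY x.toKIdx))
  {ιA AA : MemberY θ.d₆ θ.ℓ₆ θ.hd' θ.hL' θ.b₀ θ.b₁ Mstar → Type} [∀ x, Fintype (ιA x)] [∀ x, Fintype (AA x)]
  (𝔬A : ∀ x : MemberY θ.d₆ θ.ℓ₆ θ.hd' θ.hL' θ.b₀ θ.b₁ Mstar, Ops310 (geo9Y x)
    (bg9YR (Matrix (Fin N) (Fin N) ℂ) (specialUnitaryUnits (Fin N)) R₁ R₂ x) (XBK (TrIdx N) x.toKIdx) (XBK (TrIdx N) x.toKIdx) (ιA x) (AA x))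
  (rdA : ∀ x : MemberY θ.d₆ θ.ℓ₆ θ.hd' θ.hL' θ.b₀ θ.b₁ Mstar, WalkReading310 (geo9Y x)
    (bg9YR (Matrix (Fin N) (Fin N) ℂ) (specialUnitaryUnits (Fin N)) R₁ R₂ x) (XBK (TrIdx N) x.toKIdx) (ιA x) (AA x))
  (𝔬12 : ∀ x : MemberY θ.d₆ θ.ℓ₆ θ.hd' θ.hL' θ.b₀ θ.b₁ Mstar, B9Thm312Whole.Ops (geo9Y x)
    (bg9YR (Matrix (Fin N) (Fin N) ℂ) (specialUnitaryUnits (Fin N)) R₁ R₂ x) (XBK (TrIdx N) x.toKIdx) (XBK (TrIdx N) x.toKIdx) (XHK (TrIdx N) x.toKIdx)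
    (XSK (TrIdx N) x.toKIdx))

/-! ### §1 continued: field lemmas -/

/-- the three fields KEPT from the base record: the analyticity predicate (row 13's fourth slot; Sect.-B content) and the two Sect.-E predicates.
[cite: Balaban1985BackgroundPropagators, (3.69)–(3.70) p.404, Thm 3.15 (3.185)–(3.187) p.432, bookkeeping] -/
theorem expsYOfRecordV3_kept (x : MemberY θ.d₆ θ.ℓ₆ θ.hd' θ.hL' θ.b₀ θ.b₁ Mstar) :
    (expsYOfRecordV3 N θ Mstar 𝔯 𝔈₀ R₁ R₂ bI α' r39 B39 p q p3 q3 pM qM H O near 𝔬A rdA 𝔬12 x).IsAnalyticExt = (𝔈₀ x).IsAnalyticExt ∧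
      (expsYOfRecordV3 N θ Mstar 𝔯 𝔈₀ R₁ R₂ bI α' r39 B39 p q p3 q3 pM qM H O near 𝔬A rdA 𝔬12 x).GivenBy3185 = (𝔈₀ x).GivenBy3185 ∧
      (expsYOfRecordV3 N θ Mstar 𝔯 𝔈₀ R₁ R₂ bI α' r39 B39 p q p3 q3 pM qM H O near 𝔬A rdA 𝔬12 x).HasRWExpC = (𝔈₀ x).HasRWExpC := ⟨rfl, rfl, rfl⟩

/-- the record at a base that already IS a record of record is itself (the seven replaced fields do not read `𝔈₀`). [cite: Balaban1985BackgroundPropagators, Thms 3.7–3.13 pp.409–426, bookkeeping] -/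
theorem expsYOfRecordV3_idem :
    expsYOfRecordV3 N θ Mstar 𝔯 (expsYOfRecordV3 N θ Mstar 𝔯 𝔈₀ R₁ R₂ bI α' r39 B39 p q p3 q3 pM qM H O near 𝔬A rdA 𝔬12) R₁ R₂ bI α' r39 B39 p q p3 q3 pM qM H
        O near 𝔬A rdA 𝔬12 =
      expsYOfRecordV3 N θ Mstar 𝔯 𝔈₀ R₁ R₂ bI α' r39 B39 p q p3 q3 pM qM H O near 𝔬A rdA 𝔬12 := rfl

/-- the three Theorem-3.12∕3.13 fields ARE the `…OfOps` predicates of the Sect.-D letters read back to `bg9Y x`. [cite: Balaban1985BackgroundPropagators, Thm 3.12 p.423, Thm 3.13 p.426, bookkeeping] -/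
theorem expsYOfRecordV3_sectD (x : MemberY θ.d₆ θ.ℓ₆ θ.hd' θ.hL' θ.b₀ θ.b₁ Mstar) :
    (expsYOfRecordV3 N θ Mstar 𝔯 𝔈₀ R₁ R₂ bI α' r39 B39 p q p3 q3 pM qM H O near 𝔬A rdA 𝔬12 x).HasRWExp = HasRWExpOfOps (ops312RY (𝔬12 x)) ∧
      (expsYOfRecordV3 N θ Mstar 𝔯 𝔈₀ R₁ R₂ bI α' r39 B39 p q p3 q3 pM qM H O near 𝔬A rdA 𝔬12 x).HasRWExpH = HasRWExpHOfOps (ops312RY (𝔬12 x)) ∧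
      (expsYOfRecordV3 N θ Mstar 𝔯 𝔈₀ R₁ R₂ bI α' r39 B39 p q p3 q3 pM qM H O near 𝔬A rdA 𝔬12 x).PosDefK = PosDefKOfOps (ops312RY (𝔬12 x)) := ⟨rfl, rfl, rfl⟩

/-- the Theorem-3.11 field IS `PosDefOfOps` at the letters of record with the trivial parametrix proof letters. [cite: Balaban1985BackgroundPropagators, Thm 3.11 p.416, bookkeeping] -/
theorem expsYOfRecordV3_posDef (x : MemberY θ.d₆ θ.ℓ₆ θ.hd' θ.hL' θ.b₀ θ.b₁ Mstar) :
    (expsYOfRecordV3 N θ Mstar 𝔯 𝔈₀ R₁ R₂ bI α' r39 B39 p q p3 q3 pM qM H O near 𝔬A rdA 𝔬12 x).PosDef =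
      PosDefOfOps (ops311Y x (lettersYOfRecordV4P N θ Mstar 𝔯 x) (proofLettersGA (lettersYOfRecordV4P N θ Mstar 𝔯 x))) := rfl

/-- the Theorem-3.9 field, RE-TYPED over `bg9YR R₁ R₂ x`, IS `EK39OfOpsBlkVia` of the one-cube letters on the faithful block map.
[cite: Balaban1985BackgroundPropagators, Thm 3.9 (3.98)–(3.99) pp.412–413 + Thm 3.2 (3.48) p.398, bookkeeping] -/
theorem expsYOfRecordV3_EK39 (x : MemberY θ.d₆ θ.ℓ₆ θ.hd' θ.hL' θ.b₀ θ.b₁ Mstar) :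
    rwKernelExpansionR R₁ R₂ (expsYOfRecordV3 N θ Mstar 𝔯 𝔈₀ R₁ R₂ bI α' r39 B39 p q p3 q3 pM qM H O near 𝔬A rdA 𝔬12 x).EK39 =
      EK39OfOpsBlkVia (oneCubeOps39YFR θ Mstar (lettersYOfRecordV4P N θ Mstar 𝔯) R₁ R₂ bI x) (oneCubeReading39 _) (θ.d₆ + 1)
        (2 * (1 * B39) * rowConst261 (geo9Y (d := θ.d₆) (ℓ := θ.ℓ₆) (hd := θ.hd') (hL := θ.hL') (b₀ := θ.b₀) (b₁ := θ.b₁) (Mstar := Mstar)) (α' * r39))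
        ((1 - α') * r39) (repSite39F x.toKIdx (bI x)) := rfl

/-- the Theorem-3.7∕3.8 field, RE-TYPED over `bg9YR R₁ R₂ x`, IS the definite `PairM` E-letter of the walk letters at the generic cube letter `O x` ∕ reading domain `near x` fed `kernelFamilyR R₁ R₂` of the
record's own site kernel family. [cite: Balaban1985BackgroundPropagators, Thm 3.7 (3.90) p.409 + Cor. 3.8 (3.93)–(3.94) p.410, bookkeeping] -/
theorem expsYOfRecordV3_E37 (x : MemberY θ.d₆ θ.ℓ₆ θ.hd' θ.hL' θ.b₀ θ.b₁ Mstar) :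
    rwExpansionR R₁ R₂ (expsYOfRecordV3 N θ Mstar 𝔯 𝔈₀ R₁ R₂ bI α' r39 B39 p q p3 q3 pM qM H O near 𝔬A rdA 𝔬12 x).E37 =
      E37YPairMDir (bg := (bg9YR (Matrix (Fin N) (Fin N) ℂ) (specialUnitaryUnits (Fin N)) R₁ R₂)) (2 * (θ.d₆ + 1))
        (nbrCountY θ.d₆ θ.ℓ₆ θ.hd' θ.hL' θ.b₀ θ.b₁ 2) (Real.sqrt ((θ.d₆ + 1) * Fintype.card (TrIdx N))) ((θ.d₆ + 1 : ℕ) : ℝ) p q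
        (⟨p3.N3, 2 * p3.B3, 0⟩ : PairPrims) (⟨q3.N3, 2 * q3.B3, 0⟩ : PairPrims) pM qM
        (opsWalkYO x (trBasis N) (bg9YR (Matrix (Fin N) (Fin N) ℂ) (specialUnitaryUnits (Fin N)) R₁ R₂ x) (fun U => U) (parSymY x.toKIdx) (bI x) (O x))
        (dirOpsWalkYO x (trBasis N) (bg9YR (Matrix (Fin N) (Fin N) ℂ) (specialUnitaryUnits (Fin N)) R₁ R₂ x) (fun U => U) (parSymY x.toKIdx) (bI x) (O x))
        (dirLettersWalkYO x (trBasis N) (bg9YR (Matrix (Fin N) (Fin N) ℂ) (specialUnitaryUnits (Fin N)) R₁ R₂ x) (fun U => U) (parSymY x.toKIdx) (bI x) (O x))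
        (rdWalkYO x (bg9YR (Matrix (Fin N) (Fin N) ℂ) (specialUnitaryUnits (Fin N)) R₁ R₂ x) (fun U => U) (parSymY x.toKIdx) (near x)) (H x)
        (kernelFamilyR R₁ R₂
          (kernelFamilyS x.toKIdx (bg9Y (Matrix (Fin N) (Fin N) ℂ) (specialUnitaryUnits (Fin N)) x) (fun U => U) (lettersYOfRecordV4P N θ Mstar 𝔯 x).Gp
            (lettersYOfRecordV4P N θ Mstar 𝔯 x).parS)) := rfl

/-- the Theorem-3.10 field, RE-TYPED over `bg9YR R₁ R₂ x`, IS the definite `PairM` E-letter of the bond-sector readers fed `kernelFamilyR R₁ R₂` of the record's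
own bond kernel family. [cite: Balaban1985BackgroundPropagators, Thm 3.10 (3.107)–(3.108) pp.415–416, bookkeeping] -/
theorem expsYOfRecordV3_E310 (x : MemberY θ.d₆ θ.ℓ₆ θ.hd' θ.hL' θ.b₀ θ.b₁ Mstar) :
    rwExpansionR R₁ R₂ (expsYOfRecordV3 N θ Mstar 𝔯 𝔈₀ R₁ R₂ bI α' r39 B39 p q p3 q3 pM qM H O near 𝔬A rdA 𝔬12 x).E310 =
      E310YPairM (bg := (bg9YR (Matrix (Fin N) (Fin N) ℂ) (specialUnitaryUnits (Fin N)) R₁ R₂)) (2 * (θ.d₆ + 1))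
        (nbrCountY θ.d₆ θ.ℓ₆ θ.hd' θ.hL' θ.b₀ θ.b₁ 2) (Real.sqrt ((θ.d₆ + 1) * Fintype.card (TrIdx N))) ((θ.d₆ + 1 : ℕ) : ℝ) p q
        (⟨p3.N3, 2 * p3.B3, 0⟩ : PairPrims) (⟨q3.N3, 2 * q3.B3, 0⟩ : PairPrims) pM qM (𝔬A x) (rdA x) (H x)
        (kernelFamilyR R₁ R₂
          (kernelFamilyB x.toKIdx (bg9Y (Matrix (Fin N) (Fin N) ℂ) (specialUnitaryUnits (Fin N)) x) (fun U => U) (lettersYOfRecordV4P N θ Mstar 𝔯 x).GA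
            (lettersYOfRecordV4P N θ Mstar 𝔯 x).parB)) := rfl

/-! ## §2 ★★★ V3 ⊇ V2: at the cube letters `GsqY … (cubeDomY x □)` and the reading domain `nearDomY x` the record IS V2's -/

/-- ★★★ **AT THIS LINEAGE'S CUBE LETTERS AND READING DOMAIN THE RECORD IS `expsYOfRecordV2`** (`rfl` through dag-n06-d's `opsWalkYO_GsqY ∕ rdWalkYO_nearDomY`).
[cite: Balaban1985BackgroundPropagators, (3.87) p.409, p.410 L14–15, bookkeeping] -/
theorem expsYOfRecordV3_GsqY_nearDomY :
    expsYOfRecordV3 N θ Mstar 𝔯 𝔈₀ R₁ R₂ bI α' r39 B39 p q p3 q3 pM qM H (fun x c => GsqY x.toKIdx (parSymY x.toKIdx) (cubeDomY x c))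
        (fun x => nearDomY x) 𝔬A rdA 𝔬12 =
      OpsYExpsOfRecordV2.expsYOfRecordV2 N θ Mstar 𝔯 𝔈₀ R₁ R₂ bI α' r39 B39 p q p3 q3 pM qM H 𝔬A rdA 𝔬12 := rfl

/-- a certificate equation `h𝔈 : 𝔈 = expsYOfRecordV3 …` at this lineage's letters IS one for V2 (so `OpsYExpsOfRecordV2.pins_of_eq` applies verbatim).
[cite: Balaban1985BackgroundPropagators, (3.87) p.409, bookkeeping] -/
theorem eq_V2_of_eq_V3_GsqY {𝔈 : ExpsY N θ Mstar}
    (h𝔈 : 𝔈 = expsYOfRecordV3 N θ Mstar 𝔯 𝔈₀ R₁ R₂ bI α' r39 B39 p q p3 q3 pM qM H (fun x c => GsqY x.toKIdx (parSymY x.toKIdx) (cubeDomY x c))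
        (fun x => nearDomY x) 𝔬A rdA 𝔬12) :
    𝔈 = OpsYExpsOfRecordV2.expsYOfRecordV2 N θ Mstar 𝔯 𝔈₀ R₁ R₂ bI α' r39 B39 p q p3 q3 pM qM H 𝔬A rdA 𝔬12 := h𝔈

/-- conversely a V2 equation is a V3 equation at this lineage's letters. [cite: Balaban1985BackgroundPropagators, (3.87) p.409, bookkeeping] -/
theorem eq_V3_of_eq_V2 {𝔈 : ExpsY N θ Mstar}
    (h𝔈 : 𝔈 = OpsYExpsOfRecordV2.expsYOfRecordV2 N θ Mstar 𝔯 𝔈₀ R₁ R₂ bI α' r39 B39 p q p3 q3 pM qM H 𝔬A rdA 𝔬12) :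
    𝔈 = expsYOfRecordV3 N θ Mstar 𝔯 𝔈₀ R₁ R₂ bI α' r39 B39 p q p3 q3 pM qM H (fun x c => GsqY x.toKIdx (parSymY x.toKIdx) (cubeDomY x c))
        (fun x => nearDomY x) 𝔬A rdA 𝔬12 := h𝔈


/-! ## §3 ★★ The seven faces at the instances of record, in the certificate's binder shapes -/

variable (𝔢 : SectEStY N θ Mstar) (𝔴 : RWEY N θ Mstar)

/-- ★ `hEK39` at the `ν`-read STAR instance of record fed `expsYOfRecordV3`. [cite: Balaban1985BackgroundPropagators, Thm 3.9 (3.98)–(3.99) pp.412–413 + Thm 3.2 (3.48) p.398, bookkeeping] -/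
theorem pinEK39 (x : MemberY θ.d₆ θ.ℓ₆ θ.hd' θ.hL' θ.b₀ θ.b₁ Mstar) :
    rwKernelExpansionR R₁ R₂
        ((opsYNuStOfRecordV4PE N θ Mstar 𝔯 𝔢 𝔴 (expsYOfRecordV3 N θ Mstar 𝔯 𝔈₀ R₁ R₂ bI α' r39 B39 p q p3 q3 pM qM H O near 𝔬A rdA 𝔬12)) x).EK39 =
      EK39OfOpsBlkVia (oneCubeOps39YFR θ Mstar (lettersYOfRecordV4P N θ Mstar 𝔯) R₁ R₂ bI x) (oneCubeReading39 _) (θ.d₆ + 1)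
        (2 * (1 * B39) * rowConst261 (geo9Y (d := θ.d₆) (ℓ := θ.ℓ₆) (hd := θ.hd') (hL := θ.hL') (b₀ := θ.b₀) (b₁ := θ.b₁) (Mstar := Mstar)) (α' * r39))
        ((1 - α') * r39) (repSite39F x.toKIdx (bI x)) := rfl

/-- ★ `hPD` at the `ν`-read star instance of record fed `expsYOfRecordV3`. [cite: Balaban1985BackgroundPropagators, Thm 3.11 p.416, bookkeeping] -/
theorem pinPosDef (x : MemberY θ.d₆ θ.ℓ₆ θ.hd' θ.hL' θ.b₀ θ.b₁ Mstar) :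
    ((opsYNuStOfRecordV4PE N θ Mstar 𝔯 𝔢 𝔴 (expsYOfRecordV3 N θ Mstar 𝔯 𝔈₀ R₁ R₂ bI α' r39 B39 p q p3 q3 pM qM H O near 𝔬A rdA 𝔬12)) x).PosDef =
      PosDefOfOps (ops311Y x (lettersYOfRecordV4P N θ Mstar 𝔯 x) (proofLettersGA (lettersYOfRecordV4P N θ Mstar 𝔯 x))) := rfl

/-- ★ `hE37` at the `ν`-read star instance of record fed `expsYOfRecordV3` — the site kernel family on the right is `kernelFamilyR R₁ R₂` of the instance's
OWN `.Gp`, verbatim as displayed. [cite: Balaban1985BackgroundPropagators, Thm 3.7 (3.90) p.409 + Cor. 3.8 (3.93)–(3.94) p.410, bookkeeping] -/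
theorem pinE37 (x : MemberY θ.d₆ θ.ℓ₆ θ.hd' θ.hL' θ.b₀ θ.b₁ Mstar) :
    rwExpansionR R₁ R₂
        ((opsYNuStOfRecordV4PE N θ Mstar 𝔯 𝔢 𝔴 (expsYOfRecordV3 N θ Mstar 𝔯 𝔈₀ R₁ R₂ bI α' r39 B39 p q p3 q3 pM qM H O near 𝔬A rdA 𝔬12)) x).E37 =
      E37YPairMDir (bg := (bg9YR (Matrix (Fin N) (Fin N) ℂ) (specialUnitaryUnits (Fin N)) R₁ R₂)) (2 * (θ.d₆ + 1))
        (nbrCountY θ.d₆ θ.ℓ₆ θ.hd' θ.hL' θ.b₀ θ.b₁ 2) (Real.sqrt ((θ.d₆ + 1) * Fintype.card (TrIdx N))) ((θ.d₆ + 1 : ℕ) : ℝ) p q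
        (⟨p3.N3, 2 * p3.B3, 0⟩ : PairPrims) (⟨q3.N3, 2 * q3.B3, 0⟩ : PairPrims) pM qM
        (opsWalkYO x (trBasis N) (bg9YR (Matrix (Fin N) (Fin N) ℂ) (specialUnitaryUnits (Fin N)) R₁ R₂ x) (fun U => U) (parSymY x.toKIdx) (bI x) (O x))
        (dirOpsWalkYO x (trBasis N) (bg9YR (Matrix (Fin N) (Fin N) ℂ) (specialUnitaryUnits (Fin N)) R₁ R₂ x) (fun U => U) (parSymY x.toKIdx) (bI x) (O x))
        (dirLettersWalkYO x (trBasis N) (bg9YR (Matrix (Fin N) (Fin N) ℂ) (specialUnitaryUnits (Fin N)) R₁ R₂ x) (fun U => U) (parSymY x.toKIdx) (bI x) (O x))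
        (rdWalkYO x (bg9YR (Matrix (Fin N) (Fin N) ℂ) (specialUnitaryUnits (Fin N)) R₁ R₂ x) (fun U => U) (parSymY x.toKIdx) (near x)) (H x)
        (kernelFamilyR R₁ R₂
          ((opsYNuStOfRecordV4PE N θ Mstar 𝔯 𝔢 𝔴 (expsYOfRecordV3 N θ Mstar 𝔯 𝔈₀ R₁ R₂ bI α' r39 B39 p q p3 q3 pM qM H O near 𝔬A rdA 𝔬12)) x).Gp) := rfl

/-- ★ `hE310` at the `ν`-read star instance of record fed `expsYOfRecordV3` — the bond kernel family on the right is `kernelFamilyR R₁ R₂` of the instance's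
OWN `.GA`, verbatim as displayed. [cite: Balaban1985BackgroundPropagators, Thm 3.10 (3.107)–(3.108) pp.415–416, bookkeeping] -/
theorem pinE310 (x : MemberY θ.d₆ θ.ℓ₆ θ.hd' θ.hL' θ.b₀ θ.b₁ Mstar) :
    rwExpansionR R₁ R₂
        ((opsYNuStOfRecordV4PE N θ Mstar 𝔯 𝔢 𝔴 (expsYOfRecordV3 N θ Mstar 𝔯 𝔈₀ R₁ R₂ bI α' r39 B39 p q p3 q3 pM qM H O near 𝔬A rdA 𝔬12)) x).E310 =
      E310YPairM (bg := (bg9YR (Matrix (Fin N) (Fin N) ℂ) (specialUnitaryUnits (Fin N)) R₁ R₂)) (2 * (θ.d₆ + 1))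
        (nbrCountY θ.d₆ θ.ℓ₆ θ.hd' θ.hL' θ.b₀ θ.b₁ 2) (Real.sqrt ((θ.d₆ + 1) * Fintype.card (TrIdx N))) ((θ.d₆ + 1 : ℕ) : ℝ) p q
        (⟨p3.N3, 2 * p3.B3, 0⟩ : PairPrims) (⟨q3.N3, 2 * q3.B3, 0⟩ : PairPrims) pM qM (𝔬A x) (rdA x) (H x)
        (kernelFamilyR R₁ R₂
          ((opsYNuStOfRecordV4PE N θ Mstar 𝔯 𝔢 𝔴 (expsYOfRecordV3 N θ Mstar 𝔯 𝔈₀ R₁ R₂ bI α' r39 B39 p q p3 q3 pM qM H O near 𝔬A rdA 𝔬12)) x).GA) := rfl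

/-- ★ `hpinE ∕ hpinH ∕ hpinK` at the `ν`-read star instance of record fed `expsYOfRecordV3`. [cite: Balaban1985BackgroundPropagators, Thm 3.12 p.423, Thm 3.13 p.426, bookkeeping] -/
theorem pinSectD (x : MemberY θ.d₆ θ.ℓ₆ θ.hd' θ.hL' θ.b₀ θ.b₁ Mstar) :
    ((opsYNuStOfRecordV4PE N θ Mstar 𝔯 𝔢 𝔴 (expsYOfRecordV3 N θ Mstar 𝔯 𝔈₀ R₁ R₂ bI α' r39 B39 p q p3 q3 pM qM H O near 𝔬A rdA 𝔬12)) x).HasRWExp =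
        HasRWExpOfOps (ops312RY (𝔬12 x)) ∧
      ((opsYNuStOfRecordV4PE N θ Mstar 𝔯 𝔢 𝔴 (expsYOfRecordV3 N θ Mstar 𝔯 𝔈₀ R₁ R₂ bI α' r39 B39 p q p3 q3 pM qM H O near 𝔬A rdA 𝔬12)) x).HasRWExpH =
        HasRWExpHOfOps (ops312RY (𝔬12 x)) ∧
      ((opsYNuStOfRecordV4PE N θ Mstar 𝔯 𝔢 𝔴 (expsYOfRecordV3 N θ Mstar 𝔯 𝔈₀ R₁ R₂ bI α' r39 B39 p q p3 q3 pM qM H O near 𝔬A rdA 𝔬12)) x).PosDefK =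
        PosDefKOfOps (ops312RY (𝔬12 x)) := ⟨rfl, rfl, rfl⟩

/-- the analyticity predicate of the `ν`-read star instance of record fed `expsYOfRecordV3` is STILL the base record's (free). [cite: Balaban1985BackgroundPropagators, (3.69)–(3.70) p.404, bookkeeping] -/
theorem isAnalyticExt_eq (x : MemberY θ.d₆ θ.ℓ₆ θ.hd' θ.hL' θ.b₀ θ.b₁ Mstar) :
    ((opsYNuStOfRecordV4PE N θ Mstar 𝔯 𝔢 𝔴 (expsYOfRecordV3 N θ Mstar 𝔯 𝔈₀ R₁ R₂ bI α' r39 B39 p q p3 q3 pM qM H O near 𝔬A rdA 𝔬12)) x).IsAnalyticExt =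
      (𝔈₀ x).IsAnalyticExt := rfl

variable {N θ Mstar 𝔯 𝔈₀ R₁ R₂ bI α' r39 B39 p q p3 q3 pM qM H O near 𝔬A rdA 𝔬12 𝔢 𝔴}

/-- ★★★ **THE SEVEN PINS FROM ONE EQUATION** at the `ν`-read STAR instance of record (the certificate of record's `OPS`): if the certificate's `𝔈` IS
`expsYOfRecordV3 …`, the displayed binders `hEK39 ∕ hPD ∕ hE37 ∕ hE310 ∕ hpinE ∕ hpinH ∕ hpinK` hold, in exactly their shapes (obtain them with one
`obtain ⟨hEK39, hPD, hE37, hE310, hpinE, hpinH, hpinK⟩ := pins_of_eq h𝔈`).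
[cite: Balaban1985BackgroundPropagators, Thm 3.7 (3.90) p.409, Thm 3.9 (3.98)–(3.99) pp.412–413, Thm 3.10 (3.107)–(3.108) pp.415–416, Thm 3.11 p.416, Thm 3.12 p.423,
Thm 3.13 p.426, (3.35)–(3.36) p.396, bookkeeping] -/
theorem pins_of_eq {𝔈 : ExpsY N θ Mstar}
    (h𝔈 : 𝔈 = expsYOfRecordV3 N θ Mstar 𝔯 𝔈₀ R₁ R₂ bI α' r39 B39 p q p3 q3 pM qM H O near 𝔬A rdA 𝔬12) :
    (∀ x : MemberY θ.d₆ θ.ℓ₆ θ.hd' θ.hL' θ.b₀ θ.b₁ Mstar, rwKernelExpansionR R₁ R₂ ((opsYNuStOfRecordV4PE N θ Mstar 𝔯 𝔢 𝔴 𝔈) x).EK39 =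
        EK39OfOpsBlkVia (oneCubeOps39YFR θ Mstar (lettersYOfRecordV4P N θ Mstar 𝔯) R₁ R₂ bI x) (oneCubeReading39 _) (θ.d₆ + 1)
          (2 * (1 * B39) * rowConst261 (geo9Y (d := θ.d₆) (ℓ := θ.ℓ₆) (hd := θ.hd') (hL := θ.hL') (b₀ := θ.b₀) (b₁ := θ.b₁) (Mstar := Mstar)) (α' * r39))
          ((1 - α') * r39) (repSite39F x.toKIdx (bI x))) ∧
      (∀ x : MemberY θ.d₆ θ.ℓ₆ θ.hd' θ.hL' θ.b₀ θ.b₁ Mstar, ((opsYNuStOfRecordV4PE N θ Mstar 𝔯 𝔢 𝔴 𝔈) x).PosDef =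
        PosDefOfOps (ops311Y x (lettersYOfRecordV4P N θ Mstar 𝔯 x) (proofLettersGA (lettersYOfRecordV4P N θ Mstar 𝔯 x)))) ∧
      (∀ x : MemberY θ.d₆ θ.ℓ₆ θ.hd' θ.hL' θ.b₀ θ.b₁ Mstar, rwExpansionR R₁ R₂ ((opsYNuStOfRecordV4PE N θ Mstar 𝔯 𝔢 𝔴 𝔈) x).E37 =
        E37YPairMDir (bg := (bg9YR (Matrix (Fin N) (Fin N) ℂ) (specialUnitaryUnits (Fin N)) R₁ R₂)) (2 * (θ.d₆ + 1))
          (nbrCountY θ.d₆ θ.ℓ₆ θ.hd' θ.hL' θ.b₀ θ.b₁ 2) (Real.sqrt ((θ.d₆ + 1) * Fintype.card (TrIdx N))) ((θ.d₆ + 1 : ℕ) : ℝ) p q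
          (⟨p3.N3, 2 * p3.B3, 0⟩ : PairPrims) (⟨q3.N3, 2 * q3.B3, 0⟩ : PairPrims) pM qM
          (opsWalkYO x (trBasis N) (bg9YR (Matrix (Fin N) (Fin N) ℂ) (specialUnitaryUnits (Fin N)) R₁ R₂ x) (fun U => U) (parSymY x.toKIdx) (bI x) (O x))
          (dirOpsWalkYO x (trBasis N) (bg9YR (Matrix (Fin N) (Fin N) ℂ) (specialUnitaryUnits (Fin N)) R₁ R₂ x) (fun U => U) (parSymY x.toKIdx) (bI x) (O x))
          (dirLettersWalkYO x (trBasis N) (bg9YR (Matrix (Fin N) (Fin N) ℂ) (specialUnitaryUnits (Fin N)) R₁ R₂ x) (fun U => U) (parSymY x.toKIdx) (bI x) (O x))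
          (rdWalkYO x (bg9YR (Matrix (Fin N) (Fin N) ℂ) (specialUnitaryUnits (Fin N)) R₁ R₂ x) (fun U => U) (parSymY x.toKIdx) (near x)) (H x)
          (kernelFamilyR R₁ R₂ ((opsYNuStOfRecordV4PE N θ Mstar 𝔯 𝔢 𝔴 𝔈) x).Gp)) ∧
      (∀ x : MemberY θ.d₆ θ.ℓ₆ θ.hd' θ.hL' θ.b₀ θ.b₁ Mstar, rwExpansionR R₁ R₂ ((opsYNuStOfRecordV4PE N θ Mstar 𝔯 𝔢 𝔴 𝔈) x).E310 =
        E310YPairM (bg := (bg9YR (Matrix (Fin N) (Fin N) ℂ) (specialUnitaryUnits (Fin N)) R₁ R₂)) (2 * (θ.d₆ + 1))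
          (nbrCountY θ.d₆ θ.ℓ₆ θ.hd' θ.hL' θ.b₀ θ.b₁ 2) (Real.sqrt ((θ.d₆ + 1) * Fintype.card (TrIdx N))) ((θ.d₆ + 1 : ℕ) : ℝ) p q
          (⟨p3.N3, 2 * p3.B3, 0⟩ : PairPrims) (⟨q3.N3, 2 * q3.B3, 0⟩ : PairPrims) pM qM (𝔬A x) (rdA x) (H x)
          (kernelFamilyR R₁ R₂ ((opsYNuStOfRecordV4PE N θ Mstar 𝔯 𝔢 𝔴 𝔈) x).GA)) ∧
      (∀ x : MemberY θ.d₆ θ.ℓ₆ θ.hd' θ.hL' θ.b₀ θ.b₁ Mstar, ((opsYNuStOfRecordV4PE N θ Mstar 𝔯 𝔢 𝔴 𝔈) x).HasRWExp = HasRWExpOfOps (ops312RY (𝔬12 x))) ∧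
      (∀ x : MemberY θ.d₆ θ.ℓ₆ θ.hd' θ.hL' θ.b₀ θ.b₁ Mstar, ((opsYNuStOfRecordV4PE N θ Mstar 𝔯 𝔢 𝔴 𝔈) x).HasRWExpH = HasRWExpHOfOps (ops312RY (𝔬12 x))) ∧
      (∀ x : MemberY θ.d₆ θ.ℓ₆ θ.hd' θ.hL' θ.b₀ θ.b₁ Mstar, ((opsYNuStOfRecordV4PE N θ Mstar 𝔯 𝔢 𝔴 𝔈) x).PosDefK = PosDefKOfOps (ops312RY (𝔬12 x))) := by
  subst h𝔈; exact ⟨fun _ => rfl, fun _ => rfl, fun _ => rfl, fun _ => rfl, fun _ => rfl, fun _ => rfl, fun _ => rfl⟩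

/-- ★★ the same seven pins at the PLAIN STAR instance of record `opsYStOfRecordV4PE` (site-(3.49) layer without the row-26 `ν`-read).
[cite: Balaban1985BackgroundPropagators, Thm 3.7 (3.90) p.409, Thm 3.9 (3.98)–(3.99) pp.412–413, Thm 3.10 (3.107)–(3.108) pp.415–416, Thm 3.11 p.416, Thm 3.12 p.423,
Thm 3.13 p.426, (3.35)–(3.36) p.396, bookkeeping] -/
theorem pinsSt_of_eq {𝔈 : ExpsY N θ Mstar}
    (h𝔈 : 𝔈 = expsYOfRecordV3 N θ Mstar 𝔯 𝔈₀ R₁ R₂ bI α' r39 B39 p q p3 q3 pM qM H O near 𝔬A rdA 𝔬12) :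
    (∀ x : MemberY θ.d₆ θ.ℓ₆ θ.hd' θ.hL' θ.b₀ θ.b₁ Mstar, rwKernelExpansionR R₁ R₂ ((opsYStOfRecordV4PE N θ Mstar 𝔯 𝔢 𝔴 𝔈) x).EK39 =
        EK39OfOpsBlkVia (oneCubeOps39YFR θ Mstar (lettersYOfRecordV4P N θ Mstar 𝔯) R₁ R₂ bI x) (oneCubeReading39 _) (θ.d₆ + 1)
          (2 * (1 * B39) * rowConst261 (geo9Y (d := θ.d₆) (ℓ := θ.ℓ₆) (hd := θ.hd') (hL := θ.hL') (b₀ := θ.b₀) (b₁ := θ.b₁) (Mstar := Mstar)) (α' * r39))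
          ((1 - α') * r39) (repSite39F x.toKIdx (bI x))) ∧
      (∀ x : MemberY θ.d₆ θ.ℓ₆ θ.hd' θ.hL' θ.b₀ θ.b₁ Mstar, ((opsYStOfRecordV4PE N θ Mstar 𝔯 𝔢 𝔴 𝔈) x).PosDef =
        PosDefOfOps (ops311Y x (lettersYOfRecordV4P N θ Mstar 𝔯 x) (proofLettersGA (lettersYOfRecordV4P N θ Mstar 𝔯 x)))) ∧
      (∀ x : MemberY θ.d₆ θ.ℓ₆ θ.hd' θ.hL' θ.b₀ θ.b₁ Mstar, rwExpansionR R₁ R₂ ((opsYStOfRecordV4PE N θ Mstar 𝔯 𝔢 𝔴 𝔈) x).E37 =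
        E37YPairMDir (bg := (bg9YR (Matrix (Fin N) (Fin N) ℂ) (specialUnitaryUnits (Fin N)) R₁ R₂)) (2 * (θ.d₆ + 1))
          (nbrCountY θ.d₆ θ.ℓ₆ θ.hd' θ.hL' θ.b₀ θ.b₁ 2) (Real.sqrt ((θ.d₆ + 1) * Fintype.card (TrIdx N))) ((θ.d₆ + 1 : ℕ) : ℝ) p q
          (⟨p3.N3, 2 * p3.B3, 0⟩ : PairPrims) (⟨q3.N3, 2 * q3.B3, 0⟩ : PairPrims) pM qM
          (opsWalkYO x (trBasis N) (bg9YR (Matrix (Fin N) (Fin N) ℂ) (specialUnitaryUnits (Fin N)) R₁ R₂ x) (fun U => U) (parSymY x.toKIdx) (bI x) (O x))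
          (dirOpsWalkYO x (trBasis N) (bg9YR (Matrix (Fin N) (Fin N) ℂ) (specialUnitaryUnits (Fin N)) R₁ R₂ x) (fun U => U) (parSymY x.toKIdx) (bI x) (O x))
          (dirLettersWalkYO x (trBasis N) (bg9YR (Matrix (Fin N) (Fin N) ℂ) (specialUnitaryUnits (Fin N)) R₁ R₂ x) (fun U => U) (parSymY x.toKIdx) (bI x) (O x))
          (rdWalkYO x (bg9YR (Matrix (Fin N) (Fin N) ℂ) (specialUnitaryUnits (Fin N)) R₁ R₂ x) (fun U => U) (parSymY x.toKIdx) (near x)) (H x)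
          (kernelFamilyR R₁ R₂ ((opsYStOfRecordV4PE N θ Mstar 𝔯 𝔢 𝔴 𝔈) x).Gp)) ∧
      (∀ x : MemberY θ.d₆ θ.ℓ₆ θ.hd' θ.hL' θ.b₀ θ.b₁ Mstar, rwExpansionR R₁ R₂ ((opsYStOfRecordV4PE N θ Mstar 𝔯 𝔢 𝔴 𝔈) x).E310 =
        E310YPairM (bg := (bg9YR (Matrix (Fin N) (Fin N) ℂ) (specialUnitaryUnits (Fin N)) R₁ R₂)) (2 * (θ.d₆ + 1))
          (nbrCountY θ.d₆ θ.ℓ₆ θ.hd' θ.hL' θ.b₀ θ.b₁ 2) (Real.sqrt ((θ.d₆ + 1) * Fintype.card (TrIdx N))) ((θ.d₆ + 1 : ℕ) : ℝ) p q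
          (⟨p3.N3, 2 * p3.B3, 0⟩ : PairPrims) (⟨q3.N3, 2 * q3.B3, 0⟩ : PairPrims) pM qM (𝔬A x) (rdA x) (H x)
          (kernelFamilyR R₁ R₂ ((opsYStOfRecordV4PE N θ Mstar 𝔯 𝔢 𝔴 𝔈) x).GA)) ∧
      (∀ x : MemberY θ.d₆ θ.ℓ₆ θ.hd' θ.hL' θ.b₀ θ.b₁ Mstar, ((opsYStOfRecordV4PE N θ Mstar 𝔯 𝔢 𝔴 𝔈) x).HasRWExp = HasRWExpOfOps (ops312RY (𝔬12 x))) ∧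
      (∀ x : MemberY θ.d₆ θ.ℓ₆ θ.hd' θ.hL' θ.b₀ θ.b₁ Mstar, ((opsYStOfRecordV4PE N θ Mstar 𝔯 𝔢 𝔴 𝔈) x).HasRWExpH = HasRWExpHOfOps (ops312RY (𝔬12 x))) ∧
      (∀ x : MemberY θ.d₆ θ.ℓ₆ θ.hd' θ.hL' θ.b₀ θ.b₁ Mstar, ((opsYStOfRecordV4PE N θ Mstar 𝔯 𝔢 𝔴 𝔈) x).PosDefK = PosDefKOfOps (ops312RY (𝔬12 x))) := by
  subst h𝔈; exact ⟨fun _ => rfl, fun _ => rfl, fun _ => rfl, fun _ => rfl, fun _ => rfl, fun _ => rfl, fun _ => rfl⟩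

variable {𝔢' : SectEY N θ Mstar}

/-- ★★ the same seven pins at the `ν`-read SOURCE instance of record `opsYNuOfRecordV4PE` (any source Sect.-E family `𝔢'`; the editions before the star
convention and the K1 closers read it). [cite: Balaban1985BackgroundPropagators, Thm 3.7 (3.90) p.409, Thm 3.9 (3.98)–(3.99) pp.412–413, Thm 3.10 (3.107)–(3.108) pp.415–416,
Thm 3.11 p.416, Thm 3.12 p.423, Thm 3.13 p.426, (3.35)–(3.36) p.396, bookkeeping] -/
theorem pinsNu_of_eq {𝔈 : ExpsY N θ Mstar}
    (h𝔈 : 𝔈 = expsYOfRecordV3 N θ Mstar 𝔯 𝔈₀ R₁ R₂ bI α' r39 B39 p q p3 q3 pM qM H O near 𝔬A rdA 𝔬12) :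
    (∀ x : MemberY θ.d₆ θ.ℓ₆ θ.hd' θ.hL' θ.b₀ θ.b₁ Mstar, rwKernelExpansionR R₁ R₂ ((opsYNuOfRecordV4PE N θ Mstar 𝔯 𝔢' 𝔴 𝔈) x).EK39 =
        EK39OfOpsBlkVia (oneCubeOps39YFR θ Mstar (lettersYOfRecordV4P N θ Mstar 𝔯) R₁ R₂ bI x) (oneCubeReading39 _) (θ.d₆ + 1)
          (2 * (1 * B39) * rowConst261 (geo9Y (d := θ.d₆) (ℓ := θ.ℓ₆) (hd := θ.hd') (hL := θ.hL') (b₀ := θ.b₀) (b₁ := θ.b₁) (Mstar := Mstar)) (α' * r39))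
          ((1 - α') * r39) (repSite39F x.toKIdx (bI x))) ∧
      (∀ x : MemberY θ.d₆ θ.ℓ₆ θ.hd' θ.hL' θ.b₀ θ.b₁ Mstar, ((opsYNuOfRecordV4PE N θ Mstar 𝔯 𝔢' 𝔴 𝔈) x).PosDef =
        PosDefOfOps (ops311Y x (lettersYOfRecordV4P N θ Mstar 𝔯 x) (proofLettersGA (lettersYOfRecordV4P N θ Mstar 𝔯 x)))) ∧
      (∀ x : MemberY θ.d₆ θ.ℓ₆ θ.hd' θ.hL' θ.b₀ θ.b₁ Mstar, rwExpansionR R₁ R₂ ((opsYNuOfRecordV4PE N θ Mstar 𝔯 𝔢' 𝔴 𝔈) x).E37 =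
        E37YPairMDir (bg := (bg9YR (Matrix (Fin N) (Fin N) ℂ) (specialUnitaryUnits (Fin N)) R₁ R₂)) (2 * (θ.d₆ + 1))
          (nbrCountY θ.d₆ θ.ℓ₆ θ.hd' θ.hL' θ.b₀ θ.b₁ 2) (Real.sqrt ((θ.d₆ + 1) * Fintype.card (TrIdx N))) ((θ.d₆ + 1 : ℕ) : ℝ) p q
          (⟨p3.N3, 2 * p3.B3, 0⟩ : PairPrims) (⟨q3.N3, 2 * q3.B3, 0⟩ : PairPrims) pM qM
          (opsWalkYO x (trBasis N) (bg9YR (Matrix (Fin N) (Fin N) ℂ) (specialUnitaryUnits (Fin N)) R₁ R₂ x) (fun U => U) (parSymY x.toKIdx) (bI x) (O x))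
          (dirOpsWalkYO x (trBasis N) (bg9YR (Matrix (Fin N) (Fin N) ℂ) (specialUnitaryUnits (Fin N)) R₁ R₂ x) (fun U => U) (parSymY x.toKIdx) (bI x) (O x))
          (dirLettersWalkYO x (trBasis N) (bg9YR (Matrix (Fin N) (Fin N) ℂ) (specialUnitaryUnits (Fin N)) R₁ R₂ x) (fun U => U) (parSymY x.toKIdx) (bI x) (O x))
          (rdWalkYO x (bg9YR (Matrix (Fin N) (Fin N) ℂ) (specialUnitaryUnits (Fin N)) R₁ R₂ x) (fun U => U) (parSymY x.toKIdx) (near x)) (H x)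
          (kernelFamilyR R₁ R₂ ((opsYNuOfRecordV4PE N θ Mstar 𝔯 𝔢' 𝔴 𝔈) x).Gp)) ∧
      (∀ x : MemberY θ.d₆ θ.ℓ₆ θ.hd' θ.hL' θ.b₀ θ.b₁ Mstar, rwExpansionR R₁ R₂ ((opsYNuOfRecordV4PE N θ Mstar 𝔯 𝔢' 𝔴 𝔈) x).E310 =
        E310YPairM (bg := (bg9YR (Matrix (Fin N) (Fin N) ℂ) (specialUnitaryUnits (Fin N)) R₁ R₂)) (2 * (θ.d₆ + 1))
          (nbrCountY θ.d₆ θ.ℓ₆ θ.hd' θ.hL' θ.b₀ θ.b₁ 2) (Real.sqrt ((θ.d₆ + 1) * Fintype.card (TrIdx N))) ((θ.d₆ + 1 : ℕ) : ℝ) p q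
          (⟨p3.N3, 2 * p3.B3, 0⟩ : PairPrims) (⟨q3.N3, 2 * q3.B3, 0⟩ : PairPrims) pM qM (𝔬A x) (rdA x) (H x)
          (kernelFamilyR R₁ R₂ ((opsYNuOfRecordV4PE N θ Mstar 𝔯 𝔢' 𝔴 𝔈) x).GA)) ∧
      (∀ x : MemberY θ.d₆ θ.ℓ₆ θ.hd' θ.hL' θ.b₀ θ.b₁ Mstar, ((opsYNuOfRecordV4PE N θ Mstar 𝔯 𝔢' 𝔴 𝔈) x).HasRWExp = HasRWExpOfOps (ops312RY (𝔬12 x))) ∧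
      (∀ x : MemberY θ.d₆ θ.ℓ₆ θ.hd' θ.hL' θ.b₀ θ.b₁ Mstar, ((opsYNuOfRecordV4PE N θ Mstar 𝔯 𝔢' 𝔴 𝔈) x).HasRWExpH = HasRWExpHOfOps (ops312RY (𝔬12 x))) ∧
      (∀ x : MemberY θ.d₆ θ.ℓ₆ θ.hd' θ.hL' θ.b₀ θ.b₁ Mstar, ((opsYNuOfRecordV4PE N θ Mstar 𝔯 𝔢' 𝔴 𝔈) x).PosDefK = PosDefKOfOps (ops312RY (𝔬12 x))) := by
  subst h𝔈; exact ⟨fun _ => rfl, fun _ => rfl, fun _ => rfl, fun _ => rfl, fun _ => rfl, fun _ => rfl, fun _ => rfl⟩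

/-- ★★ the same seven pins at the PLAIN SOURCE instance of record `opsYOfRecordV4PE` (def-Y's v6 ∕ v7 records are its instances).
[cite: Balaban1985BackgroundPropagators, Thm 3.7 (3.90) p.409, Thm 3.9 (3.98)–(3.99) pp.412–413, Thm 3.10 (3.107)–(3.108) pp.415–416, Thm 3.11 p.416, Thm 3.12 p.423,
Thm 3.13 p.426, (3.35)–(3.36) p.396, bookkeeping] -/
theorem pinsP_of_eq {𝔈 : ExpsY N θ Mstar}
    (h𝔈 : 𝔈 = expsYOfRecordV3 N θ Mstar 𝔯 𝔈₀ R₁ R₂ bI α' r39 B39 p q p3 q3 pM qM H O near 𝔬A rdA 𝔬12) :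
    (∀ x : MemberY θ.d₆ θ.ℓ₆ θ.hd' θ.hL' θ.b₀ θ.b₁ Mstar, rwKernelExpansionR R₁ R₂ ((opsYOfRecordV4PE N θ Mstar 𝔯 𝔢' 𝔴 𝔈) x).EK39 =
        EK39OfOpsBlkVia (oneCubeOps39YFR θ Mstar (lettersYOfRecordV4P N θ Mstar 𝔯) R₁ R₂ bI x) (oneCubeReading39 _) (θ.d₆ + 1)
          (2 * (1 * B39) * rowConst261 (geo9Y (d := θ.d₆) (ℓ := θ.ℓ₆) (hd := θ.hd') (hL := θ.hL') (b₀ := θ.b₀) (b₁ := θ.b₁) (Mstar := Mstar)) (α' * r39))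
          ((1 - α') * r39) (repSite39F x.toKIdx (bI x))) ∧
      (∀ x : MemberY θ.d₆ θ.ℓ₆ θ.hd' θ.hL' θ.b₀ θ.b₁ Mstar, ((opsYOfRecordV4PE N θ Mstar 𝔯 𝔢' 𝔴 𝔈) x).PosDef =
        PosDefOfOps (ops311Y x (lettersYOfRecordV4P N θ Mstar 𝔯 x) (proofLettersGA (lettersYOfRecordV4P N θ Mstar 𝔯 x)))) ∧
      (∀ x : MemberY θ.d₆ θ.ℓ₆ θ.hd' θ.hL' θ.b₀ θ.b₁ Mstar, rwExpansionR R₁ R₂ ((opsYOfRecordV4PE N θ Mstar 𝔯 𝔢' 𝔴 𝔈) x).E37 =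
        E37YPairMDir (bg := (bg9YR (Matrix (Fin N) (Fin N) ℂ) (specialUnitaryUnits (Fin N)) R₁ R₂)) (2 * (θ.d₆ + 1))
          (nbrCountY θ.d₆ θ.ℓ₆ θ.hd' θ.hL' θ.b₀ θ.b₁ 2) (Real.sqrt ((θ.d₆ + 1) * Fintype.card (TrIdx N))) ((θ.d₆ + 1 : ℕ) : ℝ) p q
          (⟨p3.N3, 2 * p3.B3, 0⟩ : PairPrims) (⟨q3.N3, 2 * q3.B3, 0⟩ : PairPrims) pM qM
          (opsWalkYO x (trBasis N) (bg9YR (Matrix (Fin N) (Fin N) ℂ) (specialUnitaryUnits (Fin N)) R₁ R₂ x) (fun U => U) (parSymY x.toKIdx) (bI x) (O x))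
          (dirOpsWalkYO x (trBasis N) (bg9YR (Matrix (Fin N) (Fin N) ℂ) (specialUnitaryUnits (Fin N)) R₁ R₂ x) (fun U => U) (parSymY x.toKIdx) (bI x) (O x))
          (dirLettersWalkYO x (trBasis N) (bg9YR (Matrix (Fin N) (Fin N) ℂ) (specialUnitaryUnits (Fin N)) R₁ R₂ x) (fun U => U) (parSymY x.toKIdx) (bI x) (O x))
          (rdWalkYO x (bg9YR (Matrix (Fin N) (Fin N) ℂ) (specialUnitaryUnits (Fin N)) R₁ R₂ x) (fun U => U) (parSymY x.toKIdx) (near x)) (H x)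
          (kernelFamilyR R₁ R₂ ((opsYOfRecordV4PE N θ Mstar 𝔯 𝔢' 𝔴 𝔈) x).Gp)) ∧
      (∀ x : MemberY θ.d₆ θ.ℓ₆ θ.hd' θ.hL' θ.b₀ θ.b₁ Mstar, rwExpansionR R₁ R₂ ((opsYOfRecordV4PE N θ Mstar 𝔯 𝔢' 𝔴 𝔈) x).E310 =
        E310YPairM (bg := (bg9YR (Matrix (Fin N) (Fin N) ℂ) (specialUnitaryUnits (Fin N)) R₁ R₂)) (2 * (θ.d₆ + 1))
          (nbrCountY θ.d₆ θ.ℓ₆ θ.hd' θ.hL' θ.b₀ θ.b₁ 2) (Real.sqrt ((θ.d₆ + 1) * Fintype.card (TrIdx N))) ((θ.d₆ + 1 : ℕ) : ℝ) p q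
          (⟨p3.N3, 2 * p3.B3, 0⟩ : PairPrims) (⟨q3.N3, 2 * q3.B3, 0⟩ : PairPrims) pM qM (𝔬A x) (rdA x) (H x)
          (kernelFamilyR R₁ R₂ ((opsYOfRecordV4PE N θ Mstar 𝔯 𝔢' 𝔴 𝔈) x).GA)) ∧
      (∀ x : MemberY θ.d₆ θ.ℓ₆ θ.hd' θ.hL' θ.b₀ θ.b₁ Mstar, ((opsYOfRecordV4PE N θ Mstar 𝔯 𝔢' 𝔴 𝔈) x).HasRWExp = HasRWExpOfOps (ops312RY (𝔬12 x))) ∧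
      (∀ x : MemberY θ.d₆ θ.ℓ₆ θ.hd' θ.hL' θ.b₀ θ.b₁ Mstar, ((opsYOfRecordV4PE N θ Mstar 𝔯 𝔢' 𝔴 𝔈) x).HasRWExpH = HasRWExpHOfOps (ops312RY (𝔬12 x))) ∧
      (∀ x : MemberY θ.d₆ θ.ℓ₆ θ.hd' θ.hL' θ.b₀ θ.b₁ Mstar, ((opsYOfRecordV4PE N θ Mstar 𝔯 𝔢' 𝔴 𝔈) x).PosDefK = PosDefKOfOps (ops312RY (𝔬12 x))) := by
  subst h𝔈; exact ⟨fun _ => rfl, fun _ => rfl, fun _ => rfl, fun _ => rfl, fun _ => rfl, fun _ => rfl, fun _ => rfl⟩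

end Faces

end Literature.MathematicalPhysics.QuantumFieldTheory.Balaban1983to89.Node00.OpsYExpsOfRecordV3

end
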